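import Summits.QuantumFields.YangMills.Theorems.UnitScaleTiltProp7LinearCorrectorCloseHK2
import HarnessLib

/-!
# Route `UnitScaleTilt`, crux K1 «MinimiserStabilityRegPr» (stmt-QuantumFields-19200), route-R E′ path (α′): THE (E1-b) → (E1)-DOOR ADAPTER — at every member of record, the covariant (hK)
# supplier row `hKsup (κ)` (★routeR-w3's close ✓ `linCorr_gauge_le_of_hKsup_char`, characterisation exported) YIELDS the (E1)-door's socket `hLrow` (✓ `Prop7PinnedSliceRowOfThm2Datum`)
# at that member with the L-ONLY constant `C := max (3∕2·(κ√2)) (max (κ√2) C₂)` (the close's `κ√2∕ℓ_k` bounded by `κ√2`, `ℓ_k = L^{K−n} ≥ 1`)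

Cell `ym3-torus`, width seat `ym3-torus-px13` (gen 4); OFFER «(E1-b)→DOOR ADAPTER» (bus 2026-08-29).  THEOREMS ONLY (0 `def`, 0 `sorry`, 0 `instance`); `--supports stmt-QuantumFields-19200`,
count-neutral.  YM₃ on T³ is a ladder rung (R3), not the Clay problem; nothing here claims the stub, the crux, d = 4 or the gap; `hKsup` stays DISPLAYED (supplier: px22 g3's (A-cov)
member theorem over routeR-w6∕px11's transplant); small members (outside the member-of-record data `hsize hM8 hR2`) are not covered.

WHAT IS PROVED (ns `…Theorems.Prop7LinCorrRowOfHKsup`): ★★ `hLrow_of_hKsup_member` — `∃ c35 a₅ C₂ > 0, ∀ (member data, RegPr, window) (κ c) (0 ≤ κ ≤ c·ℓ_k), hKsup κ → <the door's hLrow body at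
F := ⟨ℓ+1, hL, m, hm⟩ with C := max (3∕2·(c√2)) (max (c√2) C₂)>`: instantiate the close at the knit's gauge `p := max ‖·‖ (max (ℓ_k‖D_𝒰·‖) (ℓ_k‖w·D*_𝒰D_𝒰·‖))` (`hp := rfl`) and size
`q := ℓ_k²‖D*_𝒰·‖` (`hq := le_rfl`), keep (I)(L)(pinning)(solvability), and bound the constant (`κ√2∕ℓ_k ≤ c√2`, `q ≥ 0`).
HONEST SCOPE.  Quantifier∕constant plumbing; no analytic estimate is proved here.

References: T. Bałaban, CMP 102 (1985) 277–309 [Balaban1985Variational] (Prop. 7 p.299); CMP 99 (1985) 75–102 [Balaban1985RegularSpaces] ((1.36) p.82); CMP 99 (1985) 389–434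
[Balaban1985BackgroundPropagators] ((3.3) p.390, (3.8) p.392).
-/

set_option autoImplicit false

noncomputable section

open scoped BigOperators Matrix.Norms.L2Operator Matrix

namespace Summit.QuantumFields.YangMills.Theorems.Prop7LinCorrRowOfHKsup

open Literature.MathematicalPhysics.QuantumFieldTheory.Balaban1983to89
open Literature.MathematicalPhysics.QuantumFieldTheory.Balaban1983to89.T3ContinuumYM3Torus
open Literature.MathematicalPhysics.QuantumFieldTheory.Balaban1983to89.T3PrintedRegularMinimiser (RegPr)
open Literature.MathematicalPhysics.QuantumFieldTheory.Balaban1983to89.B6GlobalChartV1 (PV)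
open B9Eq39Adjoint (covD divB)
open B9TorusCalculus (torusT)
open B10Eq27TorusAxialLog (unitsField toUField)
open B15DeterminingSets (embIter)
open Summit.QuantumFields.YangMills.Theorems.Prop7SectET3Members (hd3)
open Summit.QuantumFields.YangMills.Theorems.Prop7LinearCorrectorCloseHK2 (linCorr_gauge_le_of_hKsup_char)

variable {ℓ : ℕ} {hL : Odd (ℓ + 1) ∧ 1 < ℓ + 1}

/-- ★★ **THE (E1-b) → (E1)-DOOR ADAPTER** — at a member of record, `hKsup (κ)` with `κ ≤ c·ℓ_k` (px22: `κ = c·ℓ_k`, `c` absolute) gives the door's `hLrow` with the L-only constant `max (3∕2·(c√2)) (max (c√2) C₂)`.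
[cite: Balaban1985Variational, Prop. 7 p.299; Balaban1985RegularSpaces, (1.36) p.82; Balaban1985BackgroundPropagators, (3.3) p.390, (3.8) p.392] -/
theorem hLrow_of_hKsup_member (hℓ4 : 4 ≤ ℓ) : ∃ c35 a₅ C₂ : ℝ, 0 < c35 ∧ 0 < a₅ ∧ 0 < C₂ ∧
    ∀ (hℓ : 4 ≤ ℓ) (m : ℕ) (hm : 1 ≤ m) (n K a' R : ℕ) (hk1 : 1 ≤ K - n) (hsize : a' + 3 ≤ m + n) (hM8 : 8 ≤ (ℓ + 1) ^ a')
      (hR2 : 2 * (ℓ + 1) ^ 2 ≤ R) (α₀ : ℝ), 0 < α₀ → α₀ ≤ 1 → ((ℓ + 1 : ℕ) : ℝ) * (((ℓ + 1) ^ a' : ℕ) : ℝ) * α₀ ≤ a₅ →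
      ∀ W : GaugeField (PV 2 ℓ m K hd3 hL) 0 (Matrix.specialUnitaryGroup (Fin 2) ℂ),
        RegPr (⟨ℓ + 1, hL, m, hm⟩ : T3Family) n K α₀ W →
        (4 * 2197 * (24 * 289 * 24576 * 46116) : ℝ) * ((2 : ℕ) : ℝ) ^ 2 * ((((PV 2 ℓ m K hd3 hL).L : ℝ)) ^ (K - n)) ^ 4
            * ((((PV 2 ℓ m K hd3 hL).d : ℝ)) ^ 2 * (4 * ((2 : ℕ) : ℝ) * (α₀ * ((((PV 2 ℓ m K hd3 hL).L : ℝ))⁻¹) ^ (2 * (K - n))) ^ 2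
              + (2 * ((((ℓ + 1 : ℕ) : ℝ) ^ (K - n))⁻¹ * ((((ℓ + 1 : ℕ) : ℝ) ^ (K - n))⁻¹ * (c35 * (((ℓ + 1 : ℕ) : ℝ) * (((ℓ + 1) ^ a' : ℕ) : ℝ)) * α₀))
                  * Real.exp ((((ℓ + 1 : ℕ) : ℝ) ^ (K - n))⁻¹ * (c35 * (((ℓ + 1 : ℕ) : ℝ) * (((ℓ + 1) ^ a' : ℕ) : ℝ)) * α₀)))
                + 4 * ((((ℓ + 1 : ℕ) : ℝ) ^ (K - n))⁻¹ * (c35 * (((ℓ + 1 : ℕ) : ℝ) * (((ℓ + 1) ^ a' : ℕ) : ℝ)) * α₀)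
                  * Real.exp ((((ℓ + 1 : ℕ) : ℝ) ^ (K - n))⁻¹ * (c35 * (((ℓ + 1 : ℕ) : ℝ) * (((ℓ + 1) ^ a' : ℕ) : ℝ)) * α₀))) ^ 2) ^ 2)) ≤ 1 / 4 →
        ∀ (κ c : ℝ), 0 ≤ κ → κ ≤ c * (((⟨ℓ + 1, hL, m, hm⟩ : T3Family).L : ℕ) : ℝ) ^ (K - n) →
        (∀ (φ φH : Site (PV 2 ℓ m K hd3 hL) 0 → Matrix (Fin 2) (Fin 2) ℂ),
          (∀ y : Site (PV 2 ℓ m K hd3 hL) (K - n), φH (embIter (K - n) y) = φ (embIter (K - n) y)) →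
          (∀ x : Site (PV 2 ℓ m K hd3 hL) 0, x ∉ Set.range (embIter (K - n)) → divB (torusT (PV 2 ℓ m K hd3 hL) 0) (fun κ z => unitsField (toUField W) ⟨z, κ⟩) (fun μ => covD (torusT (PV 2 ℓ m K hd3 hL) 0) (fun κ z => unitsField (toUField W) ⟨z, κ⟩) μ (fun y => divB (torusT (PV 2 ℓ m K hd3 hL) 0) (fun κ z => unitsField (toUField W) ⟨z, κ⟩) (fun μ => covD (torusT (PV 2 ℓ m K hd3 hL) 0) (fun κ z => unitsField (toUField W) ⟨z, κ⟩) μ φH) y)) x = 0) →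
          ∀ s₁ : ℝ, (∀ z, Real.sqrt (∑ j : Fin 2, ∑ k : Fin 2, ‖(divB (torusT (PV 2 ℓ m K hd3 hL) 0) (fun κ z => unitsField (toUField W) ⟨z, κ⟩) (fun μ => covD (torusT (PV 2 ℓ m K hd3 hL) 0) (fun κ z => unitsField (toUField W) ⟨z, κ⟩) μ φ) z) j k‖ ^ 2) ≤ s₁) →
          ∀ (μ : Fin (PV 2 ℓ m K hd3 hL).d) (x : Site (PV 2 ℓ m K hd3 hL) 0),
            Real.sqrt (∑ j : Fin 2, ∑ k : Fin 2, ‖(covD (torusT (PV 2 ℓ m K hd3 hL) 0) (fun κ z => unitsField (toUField W) ⟨z, κ⟩) μ (fun y => φ y - φH y) x) j k‖ ^ 2) ≤ κ * s₁) →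
        -- THE (E1)-DOOR's SOCKET `hLrow` AT THIS MEMBER (✓ `pinnedSliceRow_of_thm2Datum`'s binder body with `F := ⟨ℓ+1, hL, m, hm⟩`, L-only constant)
        ∀ (w : Site ((⟨ℓ + 1, hL, m, hm⟩ : T3Family).P K) 0 → ℝ), (∀ (x : Site ((⟨ℓ + 1, hL, m, hm⟩ : T3Family).P K) 0) (y : Site ((⟨ℓ + 1, hL, m, hm⟩ : T3Family).P K) (K - n)), w x ≤ (Site.tdist x (embIter (K - n) y) : ℝ)) →
                  (∀ x, w x ≤ (((⟨ℓ + 1, hL, m, hm⟩ : T3Family).L : ℕ) : ℝ) ^ (K - n)) → (∀ x, 0 ≤ w x) →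
                ∃ (I : (Site ((⟨ℓ + 1, hL, m, hm⟩ : T3Family).P K) 0 → Matrix (Fin 2) (Fin 2) ℂ) →+ (Site ((⟨ℓ + 1, hL, m, hm⟩ : T3Family).P K) 0 → Matrix (Fin 2) (Fin 2) ℂ))
                  (L : (Fin ((⟨ℓ + 1, hL, m, hm⟩ : T3Family).P K).d → Site ((⟨ℓ + 1, hL, m, hm⟩ : T3Family).P K) 0 → Matrix (Fin 2) (Fin 2) ℂ) →+ (Site ((⟨ℓ + 1, hL, m, hm⟩ : T3Family).P K) 0 → Matrix (Fin 2) (Fin 2) ℂ)),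
                  -- (I) the pinned `Δ_W`-biharmonic interpolant, characterised
                  (∀ φ, ((∀ y : Site ((⟨ℓ + 1, hL, m, hm⟩ : T3Family).P K) (K - n), I φ (embIter (K - n) y) = φ (embIter (K - n) y)) ∧
                      ∀ x : Site ((⟨ℓ + 1, hL, m, hm⟩ : T3Family).P K) 0, x ∉ Set.range (embIter (K - n)) →
                        divB (torusT ((⟨ℓ + 1, hL, m, hm⟩ : T3Family).P K) 0) (fun κ z => unitsField (toUField W) ⟨z, κ⟩)
                          (fun μ => covD (torusT ((⟨ℓ + 1, hL, m, hm⟩ : T3Family).P K) 0) (fun κ z => unitsField (toUField W) ⟨z, κ⟩) μ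
                            (fun y => divB (torusT ((⟨ℓ + 1, hL, m, hm⟩ : T3Family).P K) 0) (fun κ z => unitsField (toUField W) ⟨z, κ⟩)
                              (fun ν => covD (torusT ((⟨ℓ + 1, hL, m, hm⟩ : T3Family).P K) 0) (fun κ z => unitsField (toUField W) ⟨z, κ⟩) ν (I φ)) y)) x = 0) ∧
                    ∀ χ, (∀ y : Site ((⟨ℓ + 1, hL, m, hm⟩ : T3Family).P K) (K - n), χ (embIter (K - n) y) = φ (embIter (K - n) y)) →
                      (∀ x : Site ((⟨ℓ + 1, hL, m, hm⟩ : T3Family).P K) 0, x ∉ Set.range (embIter (K - n)) →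
                        divB (torusT ((⟨ℓ + 1, hL, m, hm⟩ : T3Family).P K) 0) (fun κ z => unitsField (toUField W) ⟨z, κ⟩)
                          (fun μ => covD (torusT ((⟨ℓ + 1, hL, m, hm⟩ : T3Family).P K) 0) (fun κ z => unitsField (toUField W) ⟨z, κ⟩) μ
                            (fun y => divB (torusT ((⟨ℓ + 1, hL, m, hm⟩ : T3Family).P K) 0) (fun κ z => unitsField (toUField W) ⟨z, κ⟩)
                              (fun ν => covD (torusT ((⟨ℓ + 1, hL, m, hm⟩ : T3Family).P K) 0) (fun κ z => unitsField (toUField W) ⟨z, κ⟩) ν χ) y)) x = 0) → χ = I φ) ∧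
                  -- (L) the corrector for every potential
                  (∀ A φ, (∀ x, divB (torusT ((⟨ℓ + 1, hL, m, hm⟩ : T3Family).P K) 0) (fun κ z => unitsField (toUField W) ⟨z, κ⟩)
                        (fun μ => covD (torusT ((⟨ℓ + 1, hL, m, hm⟩ : T3Family).P K) 0) (fun κ z => unitsField (toUField W) ⟨z, κ⟩) μ φ) x
                      = divB (torusT ((⟨ℓ + 1, hL, m, hm⟩ : T3Family).P K) 0) (fun κ z => unitsField (toUField W) ⟨z, κ⟩) A x) → L A = φ - I φ) ∧
                  -- pinning
                  (∀ (A) (y : Site ((⟨ℓ + 1, hL, m, hm⟩ : T3Family).P K) (K - n)), L A (embIter (K - n) y) = 0) ∧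
                  -- solvability
                  (∀ A, ∃ φ, (∀ x, divB (torusT ((⟨ℓ + 1, hL, m, hm⟩ : T3Family).P K) 0) (fun κ z => unitsField (toUField W) ⟨z, κ⟩)
                        (fun μ => covD (torusT ((⟨ℓ + 1, hL, m, hm⟩ : T3Family).P K) 0) (fun κ z => unitsField (toUField W) ⟨z, κ⟩) μ φ) x
                      = divB (torusT ((⟨ℓ + 1, hL, m, hm⟩ : T3Family).P K) 0) (fun κ z => unitsField (toUField W) ⟨z, κ⟩) A x) ∧ L A = φ - I φ) ∧
                  ∀ A, max ‖L A‖ (max ((((⟨ℓ + 1, hL, m, hm⟩ : T3Family).L : ℕ) : ℝ) ^ (K - n) * ‖(fun μ z => covD (torusT ((⟨ℓ + 1, hL, m, hm⟩ : T3Family).P K) 0) (fun κ z => unitsField (toUField W) ⟨z, κ⟩) μ (L A) z)‖)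
                      ((((⟨ℓ + 1, hL, m, hm⟩ : T3Family).L : ℕ) : ℝ) ^ (K - n) * ‖(fun x => ((w x : ℝ) : ℂ) • divB (torusT ((⟨ℓ + 1, hL, m, hm⟩ : T3Family).P K) 0) (fun κ z => unitsField (toUField W) ⟨z, κ⟩)
                        (fun μ => covD (torusT ((⟨ℓ + 1, hL, m, hm⟩ : T3Family).P K) 0) (fun κ z => unitsField (toUField W) ⟨z, κ⟩) μ (L A)) x)‖))
                    ≤ max (3 / 2 * (c * Real.sqrt 2)) (max (c * Real.sqrt 2) C₂) * (((((⟨ℓ + 1, hL, m, hm⟩ : T3Family).L : ℕ) : ℝ) ^ (K - n)) ^ 2 * ‖(fun x => divB (torusT ((⟨ℓ + 1, hL, m, hm⟩ : T3Family).P K) 0) (fun κ z => unitsField (toUField W) ⟨z, κ⟩) A x)‖) := by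
  obtain ⟨c35, a₅, C₂, hc35, ha₅, hC₂, H⟩ := linCorr_gauge_le_of_hKsup_char (hL := hL) hℓ4
  refine ⟨c35, a₅, C₂, hc35, ha₅, hC₂, ?_⟩
  intro hℓ m hm n K a' R hk1 hsize hM8 hR2 α₀ hα₀ hα1 hMα W hreg hwin κ c hκ hκc hKsup w hwC hwℓ hw0
  obtain ⟨I, L, hI, hLφ, hLC, hsolv, hrow⟩ := H hℓ m hm n K a' R hk1 hsize hM8 hR2 α₀ hα₀ hα1 hMα W hreg hwin w hwC hwℓ hw0 _ (fun _ => rfl)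
    _ (fun _ => le_rfl) κ hκ hKsup
  refine ⟨I, L, hI, hLφ, hLC, hsolv, fun A => (hrow A).trans ?_⟩
  -- the member's constant `max (3∕2·(κ√2∕ℓ_k)) (max (κ√2∕ℓ_k) C₂)` is dominated by the L-only `max (3∕2·(c√2)) (max (c√2) C₂)` since `κ ≤ c·ℓ_k` (px22: `κ = c·ℓ_k`)
  set ℓk : ℝ := (((⟨ℓ + 1, hL, m, hm⟩ : T3Family).L : ℕ) : ℝ) ^ (K - n) with hℓk
  have hℓk0 : (0 : ℝ) < ℓk := by
    rw [hℓk]; exact pow_pos (by exact_mod_cast (show 0 < ℓ + 1 by omega)) _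
  have hdiv : κ * Real.sqrt 2 / ℓk ≤ c * Real.sqrt 2 := by
    rw [div_le_iff₀ hℓk0]
    have h2 : 0 ≤ Real.sqrt 2 := Real.sqrt_nonneg _
    nlinarith [mul_le_mul_of_nonneg_right hκc h2]
  have hq0 : 0 ≤ ℓk ^ 2 * ‖(fun x => divB (torusT (PV 2 ℓ m K hd3 hL) 0) (fun κ z => unitsField (toUField W) ⟨z, κ⟩) A x)‖ := by positivity
  exact mul_le_mul_of_nonneg_right (max_le_max (by linarith) (max_le_max hdiv le_rfl)) hq0

end Summit.QuantumFields.YangMills.Theorems.Prop7LinCorrRowOfHKsup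

end
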